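import Literature.NumberTheory.QuadraticForms.LandherrHermitianRealisation
import Literature.NumberTheory.QuadraticForms.LandherrHermitianMatrices
import Literature.AlgebraicGeometry.ShimuraVarieties.UnitaryBallQuotientDatum
import HarnessLib

/-!
# Landherr's theorem in odd rank: hermitian forms with the same signatures are similar; their unitary groups are conjugate

Topic `NumberTheory/QuadraticForms`; theorems only (no definition, no named fact, no instance).

Let `L` be a CM field with complex conjugation `σ = IsCMField.complexConj L` and `L⁺` its maximal real
subfield.  By Landherr's theorem (tree: `hermitianDiagonal_isometric_iff_invariants`,
`hermitianMatrices_congruent_iff_invariants`) a non-degenerate `σ`-hermitian form of rank `n` over `L` is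
determined up to isometry by its positive indices at the real places of `L⁺` and its discriminant in
`L⁺ˣ / N(Lˣ)`.  Rescaling `h ↦ c · h` by a totally positive `c ∈ L⁺ˣ` keeps the indices and multiplies the
discriminant by `cⁿ`; for **odd** `n = 2k + 1`, `cⁿ = c · N(cᵏ) ≡ c`, so the discriminant class can be moved
at will inside its (fixed) sign class.  Hence:

* `Landherr.hermitianDiagonal_similar_of_posCount_eq` — two non-degenerate diagonal hermitian forms of odd
  rank with the same positive index at every complex embedding are **similar**: `⟨a'⟩ ≅ c · ⟨a⟩` with
  `c = ∏ a'ᵢ / ∏ aᵢ ∈ L⁺ˣ` totally positive (its sign at `τ` is `(-1)^{n - posCount} · (-1)^{n - posCount} = +1`,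
  `Landherr.re_prod_pos_iff`);
* `hermitianMatrices_similar_of_posIndex_eq` — the same for `σ`-hermitian Gram matrices `H, H'` of odd size
  with `det ≠ 0` and equally many positive eigenvalues at every `τ`: `ᵗ(σg) · (c • H) · g = H'`, `g ∈ GL(L)`,
  `c ∈ L⁺ˣ` totally positive;
* `Landherr.unitaryGroup_smul`, `Landherr.mem_unitaryGroup_congr_iff`, `Landherr.unitaryGroup_congr_eq_comap` —
  the unitary group `U(H) ≤ GL(L)` of the tree (`Literature.AlgebraicGeometry.ShimuraVarieties.unitaryGroup`)
  does not see the scalar (`U(c • H) = U(H)`, `c ≠ 0`) and is conjugated by a congruence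
  (`U(ᵗ(σx) H x) = x⁻¹ U(H) x`); hence `unitaryGroups_conjugate_of_posIndex_eq`: **in odd rank, hermitian
  matrices with the same signatures have `GL(L)`-conjugate (in particular isomorphic) unitary groups** — the
  global counterpart of Rogawski's remark that for odd `n` the unitary group "depends only on
  `F_v^*/(F_v^*)ⁿ N_{E/F}(E_v^*)`… if `n` is odd there is a unique isomorphism class" (*Automorphic
  representations of unitary groups in three variables*, §1.9, with Landherr [L] for the global classification).

For `n = 3` and the signature `(2,1)` at one place, `(3,0)` elsewhere, this is the statement that the ambient group
`U(V₃, h)(L⁺) ⊂ GL₃(L)` of an arithmetic ball quotient ranges over a single `GL₃(L)`-conjugacy class.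

Provenance: `pub-hodgecm` package file `Proofs/LandherrSimilitude.lean` (gen 8: rank 3, PerL's signature);
generalised here to every odd rank and every signature system, in tree vocabulary.

## References

* W. Landherr, Abh. Math. Sem. Univ. Hamburg 11 (1936) 245–248 [Landherr1936HermitianForms].
* J. Rogawski, *Automorphic Representations of Unitary Groups in Three Variables*, Ann. of Math. Stud. 123
  (1990), §1.9 [Rogawski1990].
* P. Deligne, *Hodge cycles on abelian varieties*, in LNM 900 (1982), §4 Prop. 4.1, p. 44 [Deligne1982HodgeCycles].
-/

noncomputable section

open NumberField
open scoped Matrix ComplexConjugate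
open Literature.AlgebraicGeometry.ShimuraVarieties (unitaryGroup mem_unitaryGroup_iff)

namespace Literature.NumberTheory.QuadraticForms

namespace Landherr

/-! ## §0. The unitary group under rescaling and under congruence (any field, any involution) -/

section Unitary

variable {K : Type} [Field K] {m : Type} [Fintype m] [DecidableEq m]

/-- **Rescaling does not change the unitary group**: `U(c • H) = U(H)` for `c ≠ 0`. [folklore] -/
theorem unitaryGroup_smul (σ : K →+* K) {c : K} (hc : c ≠ 0) (H : Matrix m m K) :
    unitaryGroup σ (c • H) = unitaryGroup σ H := by
  ext g
  rw [mem_unitaryGroup_iff, mem_unitaryGroup_iff, Matrix.mul_smul, Matrix.smul_mul]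
  exact (smul_right_injective (Matrix m m K) hc).eq_iff

omit [DecidableEq m] in
/-- Congruences compose: `ᵗσ(xy) · H · (xy) = ᵗσy · (ᵗσx · H · x) · y`. [folklore] -/
theorem congr_mul_mul (σ : K →+* K) (x y H : Matrix m m K) :
    ((x * y).map σ)ᵀ * H * (x * y) = (y.map σ)ᵀ * (((x.map σ)ᵀ * H * x)) * y := by
  rw [Matrix.map_mul, Matrix.transpose_mul]
  simp only [Matrix.mul_assoc]

/-- The trivial congruence. [folklore] -/
theorem congr_one (σ : K →+* K) (H : Matrix m m K) : ((1 : Matrix m m K).map σ)ᵀ * H * 1 = H := by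
  rw [Matrix.map_one σ (map_zero σ) (map_one σ), Matrix.transpose_one, Matrix.one_mul, Matrix.mul_one]

/-- **Congruent Gram matrices have conjugate unitary groups**: `g ∈ U(ᵗ(σx) · H · x) ↔ x g x⁻¹ ∈ U(H)` for
`x ∈ GL`, i.e. `U(ᵗ(σx) H x) = x⁻¹ · U(H) · x`. [folklore] -/
theorem mem_unitaryGroup_congr_iff (σ : K →+* K) (x g : GL m K) (H : Matrix m m K) :
    g ∈ unitaryGroup σ (((x : Matrix m m K).map σ)ᵀ * H * (x : Matrix m m K)) ↔
      x * g * x⁻¹ ∈ unitaryGroup σ H := by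
  rw [mem_unitaryGroup_iff, mem_unitaryGroup_iff, ← congr_mul_mul, Units.val_mul, Units.val_mul]
  constructor
  · intro h
    rw [congr_mul_mul σ ((x : Matrix m m K) * (g : Matrix m m K)), h, ← congr_mul_mul, Units.mul_inv,
      congr_one]
  · intro h
    calc (((x : Matrix m m K) * (g : Matrix m m K)).map σ)ᵀ * H * ((x : Matrix m m K) * (g : Matrix m m K))
        = (((x : Matrix m m K) * (g : Matrix m m K) * ((x⁻¹ : GL m K) : Matrix m m K) * (x : Matrix m m K)).map σ)ᵀ *
            H * ((x : Matrix m m K) * (g : Matrix m m K) * ((x⁻¹ : GL m K) : Matrix m m K) * (x : Matrix m m K)) := by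
          rw [Matrix.mul_assoc ((x : Matrix m m K) * (g : Matrix m m K)), Units.inv_mul, Matrix.mul_one]
      _ = ((x : Matrix m m K).map σ)ᵀ * H * (x : Matrix m m K) := by
          rw [congr_mul_mul σ ((x : Matrix m m K) * (g : Matrix m m K) * ((x⁻¹ : GL m K) : Matrix m m K)), h]

/-- The same as an equality of subgroups of `GL`: the unitary group of a congruent Gram matrix is the pull-back of
`U(H)` under conjugation by `x`. [folklore] -/
theorem unitaryGroup_congr_eq_comap (σ : K →+* K) (x : GL m K) (H : Matrix m m K) :
    unitaryGroup σ (((x : Matrix m m K).map σ)ᵀ * H * (x : Matrix m m K)) =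
      (unitaryGroup σ H).comap (MulAut.conj x).toMonoidHom := by
  ext g
  rw [Subgroup.mem_comap, mem_unitaryGroup_congr_iff]
  rfl

/-- Hence the unitary groups of congruent Gram matrices are isomorphic (by an inner automorphism of `GL`).
[folklore] -/
theorem nonempty_mulEquiv_unitaryGroup_congr (σ : K →+* K) (x : GL m K) (H : Matrix m m K) :
    Nonempty (unitaryGroup σ (((x : Matrix m m K).map σ)ᵀ * H * (x : Matrix m m K)) ≃* unitaryGroup σ H) := by
  rw [unitaryGroup_congr_eq_comap, Subgroup.comap_equiv_eq_map_symm']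
  exact ⟨((MulAut.conj x).symm.subgroupMap (unitaryGroup σ H)).symm⟩

end Unitary

/-! ## §1. Rescaling a diagonal hermitian form by a totally positive scalar -/

section Scalar

variable (L : Type) [Field L] [NumberField L] [IsCMField L] {ι : Type} [Fintype ι]

/-- A totally positive rescaling keeps the positive index. [folklore] -/
theorem posCount_mul_of_pos {c : L} (hc : IsCMField.complexConj L c = c) (τ : L →+* ℂ) (hcτ : 0 < (τ c).re)
    (a : ι → L) : posCount L τ (fun i => c * a i) = posCount L τ a := by
  unfold posCount
  exact congrArg Finset.card (Finset.filter_congr fun i _ => by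
    rw [re_mul_of_isReal hc (a i) τ]
    exact ⟨fun h => pos_of_mul_pos_right h hcτ.le, fun h => mul_pos hcτ h⟩)

omit [NumberField L] [IsCMField L] in
/-- The discriminant of the rescaled form: `∏ (c aᵢ) = cⁿ ∏ aᵢ`. [folklore] -/
theorem prod_mul_eq_pow_mul (c : L) (a : ι → L) : ∏ i, c * a i = c ^ Fintype.card ι * ∏ i, a i := by
  rw [Finset.prod_mul_distrib, Finset.prod_const, Finset.card_univ]

/-- For two non-degenerate diagonal hermitian forms with the same positive index at every complex embedding, the
quotient of the discriminants `∏ a'ᵢ / ∏ aᵢ ∈ L⁺ˣ` is totally positive (both have the sign `(-1)^{n - posCount}`,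
`re_prod_pos_iff`). [folklore] -/
theorem re_prod_div_prod_pos {a a' : ι → L} (ha : ∀ i, IsCMField.complexConj L (a i) = a i)
    (ha' : ∀ i, IsCMField.complexConj L (a' i) = a' i) (ha0 : ∀ i, a i ≠ 0) (ha'0 : ∀ i, a' i ≠ 0)
    (hpos : ∀ τ : L →+* ℂ, posCount L τ a = posCount L τ a') (τ : L →+* ℂ) :
    0 < (τ ((∏ i, a' i) / ∏ i, a i)).re := by
  have hP : IsCMField.complexConj L (∏ i, a i) = ∏ i, a i := by
    rw [map_prod]; exact Finset.prod_congr rfl fun i _ => ha i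
  have hP' : IsCMField.complexConj L (∏ i, a' i) = ∏ i, a' i := by
    rw [map_prod]; exact Finset.prod_congr rfl fun i _ => ha' i
  have hne : (τ (∏ i, a i)).re ≠ 0 :=
    re_ne_zero_of_isReal hP (Finset.prod_ne_zero_iff.mpr fun i _ => ha0 i) τ
  have hne' : (τ (∏ i, a' i)).re ≠ 0 :=
    re_ne_zero_of_isReal hP' (Finset.prod_ne_zero_iff.mpr fun i _ => ha'0 i) τ
  have hiff : 0 < (τ (∏ i, a' i)).re ↔ 0 < (τ (∏ i, a i)).re := by
    rw [re_prod_pos_iff L ha' ha'0 τ, re_prod_pos_iff L ha ha0 τ, hpos τ]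
  rw [div_eq_mul_inv, re_mul_of_isReal hP', re_inv_of_isReal hP, ← div_eq_mul_inv]
  rcases lt_or_gt_of_ne hne with h | h
  · exact div_pos_of_neg_of_neg (lt_of_le_of_ne (not_lt.mp fun h' => (lt_asymm h) (hiff.mp h')) hne') h
  · exact div_pos (hiff.mpr h) h

end Scalar

/-! ## §2. Odd rank: same signatures ⇒ similar -/

section Similar

variable (L : Type) [Field L] [NumberField L] [IsCMField L] {ι : Type} [Fintype ι] [DecidableEq ι]

/-- **Landherr's theorem in odd rank: same signatures ⇒ similar.**  Let `⟨a⟩, ⟨a'⟩` be non-degenerate diagonal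
hermitian forms of odd rank `n` over the CM field `L` (`aᵢ, a'ᵢ ∈ L⁺ˣ`) with the same positive index at every
complex embedding.  Then `⟨a'⟩ ≅ c · ⟨a⟩` for the totally positive scalar `c = ∏ a'ᵢ / ∏ aᵢ ∈ L⁺ˣ`:
`ᵗ(σg) · diag (c a) · g = diag a'` for some `g ∈ GL(L)` (the discriminant of `c · ⟨a⟩` is
`cⁿ ∏ aᵢ = N(c^{(n-1)/2}) · ∏ a'ᵢ`). [cite: Landherr1936HermitianForms] -/
theorem hermitianDiagonal_similar_of_posCount_eq (hodd : Odd (Fintype.card ι)) (a a' : ι → L)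
    (ha : ∀ i, IsCMField.complexConj L (a i) = a i) (ha' : ∀ i, IsCMField.complexConj L (a' i) = a' i)
    (ha0 : ∀ i, a i ≠ 0) (ha'0 : ∀ i, a' i ≠ 0) (hpos : ∀ τ : L →+* ℂ, posCount L τ a = posCount L τ a') :
    ∃ c : L, IsCMField.complexConj L c = c ∧ (∀ τ : L →+* ℂ, 0 < (τ c).re) ∧
      ∃ g : GL ι L, ((g : Matrix ι ι L).transpose.map (IsCMField.complexConj L)) *
        Matrix.diagonal (fun i => c * a i) * (g : Matrix ι ι L) = Matrix.diagonal a' := by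
  obtain ⟨k, hk⟩ := hodd
  have hP : IsCMField.complexConj L (∏ i, a i) = ∏ i, a i := by
    rw [map_prod]; exact Finset.prod_congr rfl fun i _ => ha i
  have hP' : IsCMField.complexConj L (∏ i, a' i) = ∏ i, a' i := by
    rw [map_prod]; exact Finset.prod_congr rfl fun i _ => ha' i
  have hP0 : ∏ i, a i ≠ 0 := Finset.prod_ne_zero_iff.mpr fun i _ => ha0 i
  have hP'0 : ∏ i, a' i ≠ 0 := Finset.prod_ne_zero_iff.mpr fun i _ => ha'0 i
  set c : L := (∏ i, a' i) / ∏ i, a i with hc_def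
  have hc : IsCMField.complexConj L c = c := by rw [hc_def, map_div₀, hP, hP']
  have hc0 : c ≠ 0 := div_ne_zero hP'0 hP0
  have hcpos : ∀ τ : L →+* ℂ, 0 < (τ c).re := re_prod_div_prod_pos L ha ha' ha0 ha'0 hpos
  refine ⟨c, hc, hcpos, ?_⟩
  refine (hermitianDiagonal_isometric_iff_invariants L (fun i => c * a i) a'
    (fun i => by rw [map_mul, hc, ha]) ha' (fun i => mul_ne_zero hc0 (ha0 i)) ha'0).mpr ⟨fun τ => ?_, ?_⟩
  · exact (posCount_mul_of_pos L hc τ (hcpos τ) a).trans (hpos τ)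
  · refine ⟨c ^ k, pow_ne_zero k hc0, ?_⟩
    have hca : c * ∏ i, a i = ∏ i, a' i := by rw [hc_def]; exact div_mul_cancel₀ _ hP0
    rw [prod_mul_eq_pow_mul, hk, map_pow, hc, ← hca]
    ring

end Similar

end Landherr

/-! ## The theorems for Gram matrices -/

open Landherr in
/-- **Landherr's theorem in odd rank for hermitian matrices: same signatures ⇒ similar.**  Let `H, H'` be
`σ`-hermitian matrices of the same odd size over the CM field `L` with `det H, det H' ≠ 0` such that at every
complex embedding `τ` the complex hermitian matrices `τ(H)`, `τ(H')` have equally many positive eigenvalues.  Then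
`ᵗ(σg) · (c • H) · g = H'` for some `g ∈ GL(L)` and some totally positive `c ∈ L⁺ˣ`.
[cite: Landherr1936HermitianForms] -/
theorem hermitianMatrices_similar_of_posIndex_eq (L : Type) [Field L] [NumberField L] [IsCMField L]
    {ι : Type} [Fintype ι] [DecidableEq ι] (hodd : Odd (Fintype.card ι)) (H H' : Matrix ι ι L)
    (hH : H.transpose.map (IsCMField.complexConj L) = H) (hH' : H'.transpose.map (IsCMField.complexConj L) = H')
    (h0 : H.det ≠ 0) (h0' : H'.det ≠ 0)
    (hsig : ∀ τ : L →+* ℂ,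
      (Finset.univ.filter fun i => 0 < (isHermitian_map L hH τ).eigenvalues i).card =
        (Finset.univ.filter fun i => 0 < (isHermitian_map L hH' τ).eigenvalues i).card) :
    ∃ c : L, IsCMField.complexConj L c = c ∧ (∀ τ : L →+* ℂ, 0 < (τ c).re) ∧
      ∃ g : GL ι L, ((g : Matrix ι ι L).transpose.map (IsCMField.complexConj L)) * (c • H) * (g : Matrix ι ι L) =
        H' := by
  obtain ⟨G, hG, d, hd, hd0, e⟩ := exists_congr_diagonal L H hH h0
  obtain ⟨G', hG', d', hd', hd'0, e'⟩ := exists_congr_diagonal L H' hH' h0'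
  have hposd : ∀ τ : L →+* ℂ, posCount L τ d = posCount L τ d' := fun τ => by
    rw [← card_pos_eigenvalues_eq_posCount L hH hG e τ, ← card_pos_eigenvalues_eq_posCount L hH' hG' e' τ]
    exact hsig τ
  obtain ⟨c, hc, hcpos, g₀, hg₀⟩ := hermitianDiagonal_similar_of_posCount_eq L hodd d d' hd hd' hd0 hd'0 hposd
  refine ⟨c, hc, hcpos, ?_⟩
  have ec : conjTranspose L G * (c • H) * G = Matrix.diagonal fun i => c * d i := by
    rw [Matrix.mul_smul, Matrix.smul_mul, e, Matrix.smul_eq_diagonal_mul, Matrix.diagonal_mul_diagonal]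
  exact (congr_iff_isomDiag L hG ec hG' e').mpr (IsomDiag.of_gl g₀ hg₀)

open Landherr in
/-- **In odd rank, hermitian matrices with the same signatures have conjugate unitary groups.**  Under the
hypotheses of `hermitianMatrices_similar_of_posIndex_eq` there is `x ∈ GL(L)` with
`g ∈ U(H') ↔ x g x⁻¹ ∈ U(H)` for all `g ∈ GL(L)` (`U = Literature.AlgebraicGeometry.ShimuraVarieties.unitaryGroup σ`,
`σ = IsCMField.complexConj L`); in particular `U(H') ≃* U(H)`.  (Rogawski, *Automorphic representations of
unitary groups in three variables* §1.9: for odd `n` the group `U_Φ ≅ U_{λΦ}` depends only on the signatures.)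
[cite: Landherr1936HermitianForms] -/
theorem unitaryGroups_conjugate_of_posIndex_eq (L : Type) [Field L] [NumberField L] [IsCMField L]
    {ι : Type} [Fintype ι] [DecidableEq ι] (hodd : Odd (Fintype.card ι)) (H H' : Matrix ι ι L)
    (hH : H.transpose.map (IsCMField.complexConj L) = H) (hH' : H'.transpose.map (IsCMField.complexConj L) = H')
    (h0 : H.det ≠ 0) (h0' : H'.det ≠ 0)
    (hsig : ∀ τ : L →+* ℂ,
      (Finset.univ.filter fun i => 0 < (isHermitian_map L hH τ).eigenvalues i).card =
        (Finset.univ.filter fun i => 0 < (isHermitian_map L hH' τ).eigenvalues i).card) :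
    ∃ x : GL ι L, (∀ g : GL ι L, g ∈ unitaryGroup (IsCMField.complexConj L : L →+* L) H' ↔
        x * g * x⁻¹ ∈ unitaryGroup (IsCMField.complexConj L : L →+* L) H) ∧
      Nonempty (unitaryGroup (IsCMField.complexConj L : L →+* L) H' ≃*
        unitaryGroup (IsCMField.complexConj L : L →+* L) H) := by
  obtain ⟨c, hc, hcpos, x, hx⟩ := hermitianMatrices_similar_of_posIndex_eq L hodd H H' hH hH' h0 h0' hsig
  obtain ⟨τ₀⟩ : Nonempty (L →+* ℂ) := inferInstance
  have hc0 : c ≠ 0 := fun h => (lt_irrefl (0 : ℝ)) (by simpa [h] using hcpos τ₀)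
  have hx' : (((x : Matrix ι ι L).map (IsCMField.complexConj L : L →+* L))ᵀ * (c • H) * (x : Matrix ι ι L)) = H' := by
    rw [← hx, Matrix.transpose_map]
    rfl
  refine ⟨x, fun g => ?_, ?_⟩
  · rw [← hx', mem_unitaryGroup_congr_iff, unitaryGroup_smul _ hc0]
  · rw [← hx', ← unitaryGroup_smul (IsCMField.complexConj L : L →+* L) hc0 H]
    exact nonempty_mulEquiv_unitaryGroup_congr _ x (c • H)

end Literature.NumberTheory.QuadraticForms

end
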